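import Summits.Ventures.HSemireg.EquivariantExtAverage
import Summits.Ventures.HSemireg.EquivariantExtAdjunction
import HarnessLib

/-!
# Venture HSemireg — the twisted / equivariant `Ext` DICTIONARY assembled: `U` on `Extⁿ` is a bijection onto the
# INVARIANTS of the cover's `Extⁿ`, and «semiregular downstairs ⟺ σ injective on the invariants upstairs»
# (PLAN-W1-TW item T-8 (b), assembly; w1-tw-1 gen 3)

HONEST FRAMING. Composition of the tree files `EquivariantExtAverage.lean` (image = invariants, naming of the Reynolds
idempotent), `EquivariantExtAdjunction.lean` (the adjunction bijection `Φ` on `Ext`, `Φ(y ≫ η) = U(y)`) and — by a second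
route — `EquivariantExtEmbedding.lean` (w1-tw-2; injectivity). Pure homological / linear algebra over Mathlib's `Abelian.Ext`;
no gerbe, no group action on a variety, no sheaf, no Atiyah class and no semiregularity map is constructed; nothing here says
that HC, HC_CM or HC_AV holds, and nothing here is a new case of anything.

## What is assembled, and what the hypotheses ARE in the cell's model

THEOREM TW-EQ (ii)–(iii) of `run/shared/lean/pub/pub-hsemireg/widen/W1/TW-EQ-w1tw1.md`: for an `α`-twisted sheaf `E` on an
abelian anchor `A₀`, presented (descent, T-8 (a) — MODEL level, not in the tree) as an object `X` of the `G̃`-equivariant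
category `C` of the isogenous cover `A₁` with forgetful functor `U : C ⥤ D = Mod(A₁)` and co-induction `R ⊣`-right-adjoint:
`Extⁿ_α(E,E) = (Extⁿ_{A₁}(N,N))^G` (`N = U X`) and `σ_E = σ_N` on the invariants. The statements below take as DATA and
HYPOTHESES exactly the model-level identities (each elementary there, none constructible here):
* `ε`, `η` — counit and unit families (specialised to Mathlib's `adj : U ⊣ R` in the `…_of_adjunction` forms), with the
  degree-`n` ADJUNCTION BIJECTION `hΦ` (= `EquivariantExtAdjunction.comp_counit_bijective`, a THEOREM for `U ⊣ R` exact with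
  enough injectives — taken as a hypothesis in the family forms so that the file does not fix how `Φ` was obtained) and the
  left triangle identity `tri` at `X`;
* `τ_g : R U X ⟶ R U X` — the Mackey permutation action on `R U X = ⊕_g g^*X`, with `η_X ≫ τ_g = η_X` and the averaging
  retraction `r`, `r ≫ η_X = ⅟|G| • Σ_g τ_g` (and `η_X ≫ r = 𝟙` where injectivity is used);
* `ρ'_g` — the action of `G` on `Extⁿ_D(U X, U X)` (conjugation by the linearisations), INTERTWINED with `τ` by `Φ`:
  `ρ'_g (Φ x) = Φ (x ≫ τ_g)` (hypothesis `hρ'`);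
* `σ'` — any map out of `Extⁿ_D(U X, U X)` (the cover's semiregularity map `σ_N`; `σ_E := σ' ∘ U` is TW-EQ (A1)(iii)).

CONTENT (all PROVED, 0 sorry, no definitions, no named facts), namespace `Summit.Ventures.HSemireg.EquivariantExtDictionary`:
* `exists_mapExactFunctor_eq_iff_forall` — **`v ∈ Extⁿ_D(U X, U X)` is `U(y)` for some `y ∈ Extⁿ_C(X, X)` iff `ρ'_g v = v`
  for all `g`** («`Ext_α = (Ext_{A₁})^G`» as a bijection onto the invariants, given `η_X ≫ r = 𝟙` for uniqueness:
  `mapExactFunctor_injective`);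
* `injective_comp_mapExactFunctor_iff_injOn` — **`σ' ∘ U` injective on `Extⁿ_C(X,X)` ⟺ `σ'` injective ON THE INVARIANTS**
  («E semiregular ⟺ σ_N injective on `(Ext²_{A₁}(N,N))^G`», the σ-clause of the dictionary; with
  `EquivariantSigmaInvariants.injective_iff_invariants_eq_top_and_injOn`: «N semiregular ⟺ E semiregular ∧ G acts trivially»);
* `…_of_adjunction` forms of both for Mathlib's `U ⊣ R` (exact, `D` with enough injectives), where `hΦ` and `tri` are
  discharged by `EquivariantExtAdjunction.comp_counit_bijective` and the triangle identity;
* `invariants_eq_range_mapExtLinearMap`, `finrank_invariants_eq_finrank_ext` — for `k`-linear `U` and a `k`-linear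
  representation `ρ'` acting as above: `ρ'.invariants = range (U.mapExtLinearMap k X X n)` and
  **`dim_k (Extⁿ_D(U X, U X))^G = dim_k Extⁿ_C(X, X)`** (the COUNT currency: `e_n^G` of the cover object IS `e_n` of the
  twisted object).

## References (printed form of the dictionary's inputs; nothing below is used in the proofs)

* D. Mumford, *On the equations defining abelian varieties I*, Invent. Math. 1 (1966), §1. [Mumford1966EquationsI]
* R.-O. Buchweitz, H. Flenner, Compositio Math. 137 (2003), §5. [BuchweitzFlenner2003]
* J. P. Pridham, Forum Math. Sigma 12 (2024), Rem. 2.26. [Pridham2024]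
-/

noncomputable section

open CategoryTheory CategoryTheory.Abelian CategoryTheory.Limits

namespace Summit.Ventures.HSemireg.EquivariantExtDictionary

universe w w' t v v' u u' u''

section Families

variable {k : Type t} [CommRing k] {C : Type u} [Category.{v} C] [Abelian C] [Linear k C]
  {D : Type u'} [Category.{v'} D] [Abelian D]
  (U : C ⥤ D) (R : D ⥤ C) [U.Additive] [PreservesFiniteLimits U] [PreservesFiniteColimits U]
  [HasExt.{w} C] [HasExt.{w'} D]
  (ε : ∀ Y' : D, U.obj (R.obj Y') ⟶ Y') (η : ∀ Y : C, Y ⟶ R.obj (U.obj Y))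
  {G : Type u''} [Fintype G] [Invertible (Fintype.card G : k)]
  {X : C} (τ : G → (R.obj (U.obj X) ⟶ R.obj (U.obj X))) (r : R.obj (U.obj X) ⟶ X) {n : ℕ}
  (ρ' : G → Ext (U.obj X) (U.obj X) n → Ext (U.obj X) (U.obj X) n)

omit [Fintype G] [Invertible (Fintype.card G : k)] in
/-- `Φ(y ≫ η_X) = U(y)` at the one object `X`, from the left triangle identity at `X` (cf.
`EquivariantExtAdjunction.comp_eps_comp_eta`, which asks it at every object). [folklore] -/
theorem comp_eps_comp_eta_at (tri : U.map (η X) ≫ ε (U.obj X) = 𝟙 (U.obj X)) (y : Ext X X n) :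
    ((y.comp (Ext.mk₀ (η X)) (add_zero n)).mapExactFunctor U).comp (Ext.mk₀ (ε (U.obj X))) (add_zero n) =
      y.mapExactFunctor U := by
  rw [Ext.mapExactFunctor_comp, Ext.mapExactFunctor_mk₀, Ext.comp_assoc_of_third_deg_zero, Ext.mk₀_comp_mk₀, tri,
    Ext.comp_mk₀_id]

/-- **`Ext_α = (Ext_{A₁})^G` as a description of the image.** With `Φ(x) = U(x) ≫ ε_{U X}` bijective on
`Extⁿ_C(X, R U X)`, the triangle identity at `X`, the Mackey identities `η_X ≫ τ_g = η_X`, `r ≫ η_X = ⅟|G| • Σ_g τ_g`, and an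
action `ρ'` on `Extⁿ_D(U X, U X)` intertwined with `τ` by `Φ`: a class `v ∈ Extⁿ_D(U X, U X)` is of the form `U(y)`,
`y ∈ Extⁿ_C(X,X)`, iff `ρ'_g v = v` for every `g ∈ G`. [folklore] -/
theorem exists_mapExactFunctor_eq_iff_forall
    (hΦ : Function.Bijective
      (fun x : Ext X (R.obj (U.obj X)) n => (x.mapExactFunctor U).comp (Ext.mk₀ (ε (U.obj X))) (add_zero n)))
    (tri : U.map (η X) ≫ ε (U.obj X) = 𝟙 (U.obj X)) (hητ : ∀ g, η X ≫ τ g = η X)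
    (havg : r ≫ η X = ⅟(Fintype.card G : k) • ∑ g, τ g)
    (hρ' : ∀ (g : G) (x : Ext X (R.obj (U.obj X)) n),
      ρ' g ((x.mapExactFunctor U).comp (Ext.mk₀ (ε (U.obj X))) (add_zero n)) =
        ((x.comp (Ext.mk₀ (τ g)) (add_zero n)).mapExactFunctor U).comp (Ext.mk₀ (ε (U.obj X))) (add_zero n))
    (v : Ext (U.obj X) (U.obj X) n) :
    (∃ y : Ext X X n, y.mapExactFunctor U = v) ↔ ∀ g, ρ' g v = v := by
  constructor
  · rintro ⟨y, rfl⟩ g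
    rw [← comp_eps_comp_eta_at U R ε η tri y, hρ',
      EquivariantExtAverage.comp_comp_mk₀_eq τ (η X) hητ y g]
  · intro hv
    obtain ⟨x, rfl⟩ := hΦ.2 v
    have hx : ∀ g, x.comp (Ext.mk₀ (τ g)) (add_zero n) = x := fun g => hΦ.1 ((hρ' g x).symm.trans (hv g))
    obtain ⟨y, rfl⟩ :=
      (EquivariantExtAverage.exists_iff_forall_comp_mk₀_eq τ (η X) r hητ havg x).mpr hx
    exact ⟨y, (comp_eps_comp_eta_at U R ε η tri y).symm⟩

omit [Fintype G] [Invertible (Fintype.card G : k)] in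
/-- **`U` is injective on `Extⁿ_C(X,X)`** from `Φ` injective, the triangle identity at `X` and the retraction
`η_X ≫ r = 𝟙` (w1-tw-2's `EquivariantExtEmbedding` statement, here through `Φ`). [folklore] -/
theorem mapExactFunctor_injective
    (hΦ : Function.Injective
      (fun x : Ext X (R.obj (U.obj X)) n => (x.mapExactFunctor U).comp (Ext.mk₀ (ε (U.obj X))) (add_zero n)))
    (tri : U.map (η X) ≫ ε (U.obj X) = 𝟙 (U.obj X)) (hr : η X ≫ r = 𝟙 X) :
    Function.Injective (fun y : Ext X X n => y.mapExactFunctor U) := by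
  intro y₁ y₂ h
  apply EquivariantExtAverage.comp_mk₀_injective (η X) r hr n
  apply hΦ
  change ((y₁.comp (Ext.mk₀ (η X)) (add_zero n)).mapExactFunctor U).comp (Ext.mk₀ (ε (U.obj X))) (add_zero n) =
    ((y₂.comp (Ext.mk₀ (η X)) (add_zero n)).mapExactFunctor U).comp (Ext.mk₀ (ε (U.obj X))) (add_zero n)
  rw [comp_eps_comp_eta_at U R ε η tri, comp_eps_comp_eta_at U R ε η tri]
  exact h

/-- **The σ-clause of the dictionary: «`E` semiregular ⟺ `σ_N` injective on the invariants».** Under the hypotheses of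
`exists_mapExactFunctor_eq_iff_forall` and `η_X ≫ r = 𝟙`, for ANY map `σ'` out of `Extⁿ_D(U X, U X)` (the cover object's
semiregularity map): `σ' ∘ U` is injective on `Extⁿ_C(X, X)` iff `σ'` is injective on `{v | ρ'_g v = v ∀ g}`. [folklore] -/
theorem injective_comp_mapExactFunctor_iff_injOn {W : Type*} (σ' : Ext (U.obj X) (U.obj X) n → W)
    (hΦ : Function.Bijective
      (fun x : Ext X (R.obj (U.obj X)) n => (x.mapExactFunctor U).comp (Ext.mk₀ (ε (U.obj X))) (add_zero n)))
    (tri : U.map (η X) ≫ ε (U.obj X) = 𝟙 (U.obj X)) (hr : η X ≫ r = 𝟙 X) (hητ : ∀ g, η X ≫ τ g = η X)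
    (havg : r ≫ η X = ⅟(Fintype.card G : k) • ∑ g, τ g)
    (hρ' : ∀ (g : G) (x : Ext X (R.obj (U.obj X)) n),
      ρ' g ((x.mapExactFunctor U).comp (Ext.mk₀ (ε (U.obj X))) (add_zero n)) =
        ((x.comp (Ext.mk₀ (τ g)) (add_zero n)).mapExactFunctor U).comp (Ext.mk₀ (ε (U.obj X))) (add_zero n)) :
    Function.Injective (fun y : Ext X X n => σ' (y.mapExactFunctor U)) ↔
      Set.InjOn σ' {v | ∀ g, ρ' g v = v} := by
  have himg := exists_mapExactFunctor_eq_iff_forall U R ε η τ r ρ' hΦ tri hητ havg hρ'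
  constructor
  · intro hinj v hv v' hv' hvv'
    obtain ⟨y, rfl⟩ := (himg v).mpr hv
    obtain ⟨y', rfl⟩ := (himg v').mpr hv'
    rw [hinj hvv']
  · intro hon y₁ y₂ h
    exact mapExactFunctor_injective U R ε η r hΦ.1 tri hr
      (hon ((himg _).mp ⟨y₁, rfl⟩) ((himg _).mp ⟨y₂, rfl⟩) h)

end Families

/-! ### The same for Mathlib's adjunction `U ⊣ R` (exact pair, `D` with enough injectives) -/

section OfAdjunction

variable {k : Type t} [CommRing k] {C : Type u} [Category.{v} C] [Abelian C] [Linear k C]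
  {D : Type u'} [Category.{v'} D] [Abelian D]
  (U : C ⥤ D) (R : D ⥤ C) [U.Additive] [R.Additive] [PreservesFiniteLimits U] [PreservesFiniteColimits U]
  [PreservesFiniteLimits R] [PreservesFiniteColimits R] [HasExt.{w} C] [HasExt.{w'} D] [EnoughInjectives D]
  (adj : U ⊣ R) {G : Type u''} [Fintype G] [Invertible (Fintype.card G : k)]
  {X : C} (τ : G → (R.obj (U.obj X) ⟶ R.obj (U.obj X))) (r : R.obj (U.obj X) ⟶ X) {n : ℕ}
  (ρ' : G → Ext (U.obj X) (U.obj X) n → Ext (U.obj X) (U.obj X) n)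

/-- **`Ext_α = (Ext_{A₁})^G` for `U ⊣ R`.** For an adjunction `U ⊣ R` of exact additive functors between abelian
categories (`C` `k`-linear, `D` with enough injectives), the Mackey identities at `X` for `τ`, `r` and the unit, and an
action `ρ'` on `Extⁿ_D(U X, U X)` with `ρ'_g (U(x) ≫ ε) = U(x ≫ τ_g) ≫ ε`: `v = U(y)` for some `y ∈ Extⁿ_C(X,X)` iff
`ρ'_g v = v` for all `g`. [folklore] -/
theorem exists_mapExtAddHom_eq_iff_forall_of_adjunction (hητ : ∀ g, adj.unit.app X ≫ τ g = adj.unit.app X)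
    (havg : r ≫ adj.unit.app X = ⅟(Fintype.card G : k) • ∑ g, τ g)
    (hρ' : ∀ (g : G) (x : Ext X (R.obj (U.obj X)) n),
      ρ' g ((x.mapExactFunctor U).comp (Ext.mk₀ (adj.counit.app (U.obj X))) (add_zero n)) =
        ((x.comp (Ext.mk₀ (τ g)) (add_zero n)).mapExactFunctor U).comp (Ext.mk₀ (adj.counit.app (U.obj X)))
          (add_zero n))
    (v : Ext (U.obj X) (U.obj X) n) :
    (∃ y : Ext X X n, U.mapExtAddHom X X n y = v) ↔ ∀ g, ρ' g v = v :=
  exists_mapExactFunctor_eq_iff_forall U R (fun Z => adj.counit.app Z) (fun Z => adj.unit.app Z) τ r ρ'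
    (EquivariantExtAdjunction.comp_counit_bijective U R adj X (U.obj X) n) (adj.left_triangle_components X) hητ havg
    hρ' v

/-- **The σ-clause for `U ⊣ R`: «`E` semiregular ⟺ `σ_N` injective on the `G`-invariants of `Ext_{A₁}(N,N)`».** Same
hypotheses plus the averaging retraction `η_X ≫ r = 𝟙`; `σ'` any map out of `Extⁿ_D(U X, U X)`. [folklore] -/
theorem injective_comp_mapExtAddHom_iff_injOn_of_adjunction {W : Type*} (σ' : Ext (U.obj X) (U.obj X) n → W)
    (hr : adj.unit.app X ≫ r = 𝟙 X) (hητ : ∀ g, adj.unit.app X ≫ τ g = adj.unit.app X)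
    (havg : r ≫ adj.unit.app X = ⅟(Fintype.card G : k) • ∑ g, τ g)
    (hρ' : ∀ (g : G) (x : Ext X (R.obj (U.obj X)) n),
      ρ' g ((x.mapExactFunctor U).comp (Ext.mk₀ (adj.counit.app (U.obj X))) (add_zero n)) =
        ((x.comp (Ext.mk₀ (τ g)) (add_zero n)).mapExactFunctor U).comp (Ext.mk₀ (adj.counit.app (U.obj X)))
          (add_zero n)) :
    Function.Injective (fun y : Ext X X n => σ' (U.mapExtAddHom X X n y)) ↔ Set.InjOn σ' {v | ∀ g, ρ' g v = v} :=
  injective_comp_mapExactFunctor_iff_injOn U R (fun Z => adj.counit.app Z) (fun Z => adj.unit.app Z) τ r ρ' σ'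
    (EquivariantExtAdjunction.comp_counit_bijective U R adj X (U.obj X) n) (adj.left_triangle_components X) hr hητ
    havg hρ'

end OfAdjunction

/-! ### COUNT currency: `dim (Extⁿ_D(U X, U X))^G = dim Extⁿ_C(X, X)` for `k`-linear data -/

section Linear

variable {k : Type t} [CommRing k] {C : Type u} [Category.{v} C] [Abelian C] [Linear k C]
  {D : Type u'} [Category.{v'} D] [Abelian D] [Linear k D]
  (U : C ⥤ D) (R : D ⥤ C) [U.Additive] [U.Linear k] [PreservesFiniteLimits U] [PreservesFiniteColimits U]
  [HasExt.{w} C] [HasExt.{w'} D]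
  (ε : ∀ Y' : D, U.obj (R.obj Y') ⟶ Y') (η : ∀ Y : C, Y ⟶ R.obj (U.obj Y))
  {G : Type u''} [Group G] [Fintype G] [Invertible (Fintype.card G : k)]
  {X : C} (τ : G → (R.obj (U.obj X) ⟶ R.obj (U.obj X))) (r : R.obj (U.obj X) ⟶ X) {n : ℕ}
  (ρ' : Representation k G (Ext (U.obj X) (U.obj X) n))

/-- **The invariants ARE the range of `U` on `Ext`, as `k`-submodules** (for `k`-linear `U` and a `k`-linear
representation `ρ'` of `G` on `Extⁿ_D(U X, U X)` intertwined with `τ` by `Φ`). [folklore] -/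
theorem invariants_eq_range_mapExtLinearMap
    (hΦ : Function.Bijective
      (fun x : Ext X (R.obj (U.obj X)) n => (x.mapExactFunctor U).comp (Ext.mk₀ (ε (U.obj X))) (add_zero n)))
    (tri : U.map (η X) ≫ ε (U.obj X) = 𝟙 (U.obj X)) (hητ : ∀ g, η X ≫ τ g = η X)
    (havg : r ≫ η X = ⅟(Fintype.card G : k) • ∑ g, τ g)
    (hρ' : ∀ (g : G) (x : Ext X (R.obj (U.obj X)) n),
      ρ' g ((x.mapExactFunctor U).comp (Ext.mk₀ (ε (U.obj X))) (add_zero n)) =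
        ((x.comp (Ext.mk₀ (τ g)) (add_zero n)).mapExactFunctor U).comp (Ext.mk₀ (ε (U.obj X))) (add_zero n)) :
    ρ'.invariants = LinearMap.range (U.mapExtLinearMap k X X n) := by
  ext v
  rw [Representation.mem_invariants, LinearMap.mem_range]
  simp only [Functor.mapExtLinearMap_apply]
  exact (exists_mapExactFunctor_eq_iff_forall U R ε η τ r (fun g => ρ' g) hΦ tri hητ havg hρ' v).symm

/-- **COUNT currency.** Under the same hypotheses and the averaging retraction `η_X ≫ r = 𝟙`:
`dim_k (Extⁿ_D(U X, U X))^G = dim_k Extⁿ_C(X, X)` (`Module.finrank`): the invariant `e_n^G` of the cover object `N = U X`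
is the `e_n` of the twisted / equivariant object `X` — the number the cell's equivariant COUNT laws read. [folklore] -/
theorem finrank_invariants_eq_finrank_ext
    (hΦ : Function.Bijective
      (fun x : Ext X (R.obj (U.obj X)) n => (x.mapExactFunctor U).comp (Ext.mk₀ (ε (U.obj X))) (add_zero n)))
    (tri : U.map (η X) ≫ ε (U.obj X) = 𝟙 (U.obj X)) (hr : η X ≫ r = 𝟙 X) (hητ : ∀ g, η X ≫ τ g = η X)
    (havg : r ≫ η X = ⅟(Fintype.card G : k) • ∑ g, τ g)
    (hρ' : ∀ (g : G) (x : Ext X (R.obj (U.obj X)) n),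
      ρ' g ((x.mapExactFunctor U).comp (Ext.mk₀ (ε (U.obj X))) (add_zero n)) =
        ((x.comp (Ext.mk₀ (τ g)) (add_zero n)).mapExactFunctor U).comp (Ext.mk₀ (ε (U.obj X))) (add_zero n)) :
    Module.finrank k ρ'.invariants = Module.finrank k (Ext X X n) := by
  rw [invariants_eq_range_mapExtLinearMap U R ε η τ r ρ' hΦ tri hητ havg hρ']
  apply LinearMap.finrank_range_of_inj
  intro y₁ y₂ h
  simp only [Functor.mapExtLinearMap_apply] at h
  exact mapExactFunctor_injective U R ε η r hΦ.1 tri hr h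

end Linear

end Summit.Ventures.HSemireg.EquivariantExtDictionary

end
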